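import Summits.Ventures.HSemireg.EmbeddedFirstOrderDeformationsCechNonzeroClass

/-!
# Venture HSemireg — `𝒪_{ℙ¹}(−n)` for EVERY `n ≥ 2`: the zero section does not lift along the shear `s⁻¹∂/∂p`
# (the general-exponent form of `…CechMinusTwoCurve`, which is the case `n = 2`)

HONEST FRAMING.  Lean side of the computation cell `pub-hsemireg` (track «S4-PUSH» (ii), seat s4-prove-3 g6, second
route for (S5)); log `s4push/prove-3/ATTEMPT-10.md` §5k.  Same charts `k[s,p]`, `k[t,q]`, overlap `k[s,s⁻¹,p]`,
zero section `Z = V(p) ∪ V(q)` and twist `θ = s⁻¹∂/∂p` as `…CechMinusTwoCurve`, with the gluing `t = s⁻¹`,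
`q = s^{m+1}p` (the total space of `𝒪_{ℙ¹}(−m−1)`), `m ≥ 1` a parameter: the (0,1) coboundary equation reads
`s^m ≡ H(s⁻¹, s^{m+1}p) − s^{m+1}G (mod p)`, i.e. `x^m − (H(x⁻¹) − x^{m+1}G) = 0` in `k[x]_x` — impossible (the
coefficient of `x^{m+N}` after clearing denominators is `1 = 0`).  The text is `…CechMinusTwoCurve` with the exponent
`2` replaced by `m + 1` (the case `m = 1` is that file verbatim).  Plain commutative algebra; no Mathlib scheme, sheaf,
abelian variety or semiregularity map; nothing here says that HC, HC_CM or HC_AV holds; no object is certified; no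
Literature fact is declared.

WHAT (namespace `Summit.Ventures.HSemireg.EmbeddedDeformation.DoubledLine`; parameter `m : ℕ`):
`psiN₀/psiNHom/psiN k m` (`s ↦ s⁻¹`, `p ↦ s^{m+1}p`, an involution), `resMN`, `preservesLifts_resMN`,
`thickenedAtlas_minusN`, `key_contradiction_pow` (`m ≥ 1`), **`not_exists_isAtlasLift_minusN`** (`m ≥ 1`: the zero
section of `𝒪_{ℙ¹}(−m−1)` has NO lift), `cechCochain_minusN_not_coboundary`.  With `…CechTrivialBundle` (`𝒪(0)`:
lifts, not uniquely) and `…CechMinusOneCurve`/`…Rigid` (`𝒪(−1)`: unique lift) this is the complete ladder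
`𝒪(−n)`, `n ≥ 0`, for the one twist `s⁻¹∂/∂p`: lift ⟺ `n ≤ 1`, unique ⟺ `n = 1`.

References: R. Hartshorne, *Deformation Theory*, GTM 257 (2010), §6 Thm. 6.2 (b) [corpus:
book:springernd-deformation-theory p0054]; `H¹(ℙ¹, 𝒪(−n)) ≠ 0 ⟺ n ≥ 2` [folklore].
-/

namespace Summit.Ventures.HSemireg

namespace EmbeddedDeformation

namespace DoubledLine

open DualNumber TrivSqZeroExt MvPolynomial

universe u

variable (k : Type u) [CommRing k] (m : ℕ)

/-! ### §2 The coordinate change `s ↦ s⁻¹, p ↦ s^{m+1}p` of the `(−m−1)`-bundle and the two chart maps -/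

/-- `k[s,p] → k[s,s⁻¹,p]`, `s ↦ s⁻¹`, `p ↦ s^{m+1}p` (the second chart of `𝒪_{ℙ¹}(−m−1)` read in the first chart's
overlap coordinates: `t = s⁻¹`, `q = s^{m+1}p`). -/
noncomputable def psiN₀ : A k →+* L k :=
  (MvPolynomial.aeval ![IsLocalization.Away.invSelf (X 0 : A k),
    algebraMap (A k) (L k) (X 0) ^ (m + 1) * algebraMap (A k) (L k) (X 1)]).toRingHom

/-- `psiN₀ s = s⁻¹`. [folklore] -/
theorem psiN₀_X_zero : psiN₀ k m (X 0) = IsLocalization.Away.invSelf (X 0 : A k) := by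
  rw [psiN₀, AlgHom.toRingHom_eq_coe, AlgHom.coe_toRingHom, MvPolynomial.aeval_X]; rfl

/-- `psiN₀ p = s^{m+1}p`. [folklore] -/
theorem psiN₀_X_one : psiN₀ k m (X 1) = algebraMap (A k) (L k) (X 0) ^ (m + 1) * algebraMap (A k) (L k) (X 1) := by
  rw [psiN₀, AlgHom.toRingHom_eq_coe, AlgHom.coe_toRingHom, MvPolynomial.aeval_X]; rfl

/-- `psiN₀` on constants. [folklore] -/
theorem psiN₀_C (c : k) : psiN₀ k m (C c) = algebraMap (A k) (L k) (C c) := by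
  rw [psiN₀, AlgHom.toRingHom_eq_coe, AlgHom.coe_toRingHom, MvPolynomial.algHom_C, ← MvPolynomial.algebraMap_eq]
  exact IsScalarTower.algebraMap_apply k (A k) (L k) c

/-- `s⁻¹ · s = 1`, so `psiN₀ s` is a unit. [folklore] -/
theorem isUnit_psiN₀_X_zero : IsUnit (psiN₀ k m (X 0)) := by
  rw [psiN₀_X_zero]
  exact IsUnit.of_mul_eq_one_right _ (IsLocalization.Away.mul_invSelf (S := L k) (X 0 : A k))

/-- The coordinate change extended to `L = k[s,s⁻¹,p]`. [folklore] -/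
noncomputable def psiNHom : L k →+* L k :=
  IsLocalization.Away.lift (X 0 : A k) (isUnit_psiN₀_X_zero k m)

/-- `psiNHom (a/1) = psiN₀ a`. [folklore] -/
theorem psiNHom_algebraMap (a : A k) : psiNHom k m (algebraMap (A k) (L k) a) = psiN₀ k m a :=
  IsLocalization.Away.lift_eq (X 0 : A k) (isUnit_psiN₀_X_zero k m) a

/-- `psiNHom (s⁻¹) = s`. [folklore] -/
theorem psiNHom_invSelf : psiNHom k m (IsLocalization.Away.invSelf (X 0 : A k)) = algebraMap (A k) (L k) (X 0) := by
  have h1 : psiNHom k m (algebraMap (A k) (L k) (X 0)) * psiNHom k m (IsLocalization.Away.invSelf (X 0 : A k)) = 1 := by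
    rw [← map_mul, IsLocalization.Away.mul_invSelf, map_one]
  rw [psiNHom_algebraMap, psiN₀_X_zero] at h1
  -- `s⁻¹ · psiNHom(s⁻¹) = 1` and `s⁻¹ · s = 1`
  have h2 : IsLocalization.Away.invSelf (X 0 : A k) * algebraMap (A k) (L k) (X 0) = 1 := by
    rw [mul_comm, IsLocalization.Away.mul_invSelf]
  calc psiNHom k m (IsLocalization.Away.invSelf (X 0 : A k))
      = (IsLocalization.Away.invSelf (X 0 : A k) * algebraMap (A k) (L k) (X 0)) *
          psiNHom k m (IsLocalization.Away.invSelf (X 0 : A k)) := by rw [h2, one_mul]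
    _ = algebraMap (A k) (L k) (X 0) *
          (IsLocalization.Away.invSelf (X 0 : A k) * psiNHom k m (IsLocalization.Away.invSelf (X 0 : A k))) := by ring
    _ = algebraMap (A k) (L k) (X 0) := by rw [h1, mul_one]

/-- **`psiNHom` is an involution** (`s ↦ s⁻¹ ↦ s`, `p ↦ s^{m+1}p ↦ p`). [folklore] -/
theorem psiNHom_comp_psiNHom : (psiNHom k m).comp (psiNHom k m) = RingHom.id (L k) := by
  refine IsLocalization.ringHom_ext (Submonoid.powers (X 0 : A k)) ?_
  refine MvPolynomial.ringHom_ext (fun c ↦ ?_) (fun i ↦ ?_)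
  · simp only [RingHom.comp_apply, RingHom.id_apply, ← MvPolynomial.algebraMap_eq]
    rw [MvPolynomial.algebraMap_eq, psiNHom_algebraMap, psiN₀_C, psiNHom_algebraMap, psiN₀_C]
  · simp only [RingHom.comp_apply, RingHom.id_apply]
    fin_cases i
    · simp only [Fin.zero_eta, psiNHom_algebraMap, psiN₀_X_zero, psiNHom_invSelf]
    · simp only [Fin.mk_one, psiNHom_algebraMap, psiN₀_X_one, map_mul, map_pow, psiN₀_X_zero]
      rw [← mul_assoc, ← mul_pow, mul_comm (IsLocalization.Away.invSelf _), IsLocalization.Away.mul_invSelf, one_pow,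
        one_mul]

/-- The coordinate change as a ring AUTOMORPHISM `psi : L ≃+* L`. [folklore] -/
noncomputable def psiN : L k ≃+* L k :=
  RingEquiv.ofRingHom (psiNHom k m) (psiNHom k m) (psiNHom_comp_psiNHom k m) (psiNHom_comp_psiNHom k m)

/-- The chart maps of `𝒪_{ℙ¹}(−m−1)` into the overlap: chart `0` the localisation, chart `1` the localisation followed
by the coordinate change. -/
noncomputable def resMN : Fin 2 → (A k →+* L k) :=
  ![algebraMap (A k) (L k), (psiN k m : L k →+* L k).comp (algebraMap (A k) (L k))]

/-- `resMN 1 = psi ∘` localisation. -/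
theorem resMN_one : resMN k m 1 = (psiN k m : L k →+* L k).comp (algebraMap (A k) (L k)) := rfl

/-- `resMN 1 (p) = s^{m+1}p`. [folklore] -/
theorem resMN_one_X_one :
    resMN k m 1 (X 1) = algebraMap (A k) (L k) (X 0) ^ (m + 1) * algebraMap (A k) (L k) (X 1) := by
  rw [resMN_one, RingHom.comp_apply]
  change psiNHom k m _ = _
  rw [psiNHom_algebraMap, psiN₀_X_one]

/-- `(p)·L` is `psiN`-stable: `psiN((p)·L) = (s^{m+1}p)·L = (p)·L`. [folklore] -/
theorem map_psiN_idealZ₂ (α β : Fin 2) :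
    (idealZ₂ k α β).map (psiN k m : L k →+* L k) = idealZ₂ k α β := by
  change ((Ideal.span {(X 1 : A k)}).map _).map _ = (Ideal.span {(X 1 : A k)}).map _
  rw [Ideal.map_map, Ideal.map_span, Ideal.map_span, Set.image_singleton, Set.image_singleton, RingHom.comp_apply]
  change Ideal.span {psiNHom k m _} = _
  rw [psiNHom_algebraMap, psiN₀_X_one]
  exact Ideal.span_singleton_mul_left_unit ((IsLocalization.Away.algebraMap_isUnit (S := L k) (X 0 : A k)).pow (m + 1)) _

/-- **Both chart maps carry flat lifts** (chart `0`: the localisation discharger; chart `1`: localisation, then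
transport along the automorphism `psi[ε]` over `psi`, then `psi`-stability of `(p)·L`). [folklore] -/
theorem preservesLifts_resMN : ∀ α β : Fin 2,
    PreservesLifts (fstRingHom (A k)) (ε : (A k)[ε]) (fstRingHom (L k)) (ε : (L k)[ε]) (mapRingHom (resMN k m α))
      (idealZ k α) (idealZ₂ k α β) := by
  intro α β
  fin_cases α
  · exact preservesLifts_mapRingHom_of_isLocalization (Submonoid.powers (X 0 : A k)) _
  · show PreservesLifts _ _ _ _ (mapRingHom (resMN k m 1)) (idealZ k 1) (idealZ₂ k 1 β)
    rw [resMN_one, mapRingHom_comp', ← coe_mapRingEquiv]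
    intro K hK
    have h1 := preservesLifts_mapRingHom_of_isLocalization (S := L k) (Submonoid.powers (X 0 : A k)) (idealZ k 1) hK
    have h2 := h1.map_ringEquivPair (τ := fstRingHom (L k)) (e' := (ε : (L k)[ε])) (mapRingEquiv (psiN k m)) (psiN k m)
      (fun z ↦ by
        show (mapRingHom (psiN k m : L k →+* L k) z).fst = psiN k m z.fst
        exact fst_mapRingHom _ z)
      (by
        show mapRingHom (psiN k m : L k →+* L k) ε = ε
        exact mapRingHom_eps _)
    rw [Ideal.map_map, Ideal.map_map] at h2
    have h3 : (idealZ k 1).map ((psiN k m : L k →+* L k).comp (algebraMap (A k) (L k))) = idealZ₂ k 1 β := by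
      rw [← Ideal.map_map]
      exact map_psiN_idealZ₂ k m 1 β
    rw [h3] at h2
    exact h2

/-! ### §3 The zero section of `𝒪_{ℙ¹}(−m−1)` (`m ≥ 1`) does not lift -/

/-- **The total space of `𝒪_{ℙ¹}(−m−1)` with the twisted deformation IS a thickened atlas** (charts `k[s,p][ε]`,
`k[t,q][ε]` — the same ring — overlap `k[s,s⁻¹,p][ε]`, chart maps `resMN`, twist `θ_αβ = (β − α)·s⁻¹∂/∂p`, so that
`q ↦ s^{m+1}p + εs^m`). [folklore] -/
theorem thickenedAtlas_minusN :
    ThickenedAtlas (fun _ : Fin 2 ↦ fstRingHom (A k)) (fun _ ↦ (ε : (A k)[ε])) (fun _ _ ↦ fstRingHom (L k))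
      (fun _ _ ↦ (ε : (L k)[ε])) (fun α _ ↦ mapRingHom (resMN k m α)) (fun α _ ↦ resMN k m α)
      (fun α β ↦ (twist (thetaFamily k α β) : (L k)[ε] →+* (L k)[ε]).comp (mapRingHom (resMN k m β)))
      (fun _ β ↦ resMN k m β) (idealZ k) (idealZ₂ k) :=
  thickenedAtlas_twisted (fun α _ ↦ resMN k m α) (fun _ β ↦ resMN k m β) (idealZ k) (idealZ₂ k) (thetaFamily k)
    (preservesLifts_resMN k m) (fun α β ↦ preservesLifts_resMN k m β α)

/-- `ev ∘ psiN₀ : k[s,p] → k[x]_x` is `s ↦ x⁻¹, p ↦ 0` (`x⁻¹ := ev s⁻¹`). [folklore] -/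
theorem ev_comp_psiN₀ :
    (ev k).comp (psiN₀ k m) =
      MvPolynomial.eval₂Hom (algebraMap k (Localization.Away (Polynomial.X : Polynomial k)))
        ![ev k (IsLocalization.Away.invSelf (X 0 : A k)), 0] := by
  refine MvPolynomial.ringHom_ext (fun c ↦ ?_) (fun i ↦ ?_)
  · rw [RingHom.comp_apply, psiN₀_C, ev_algebraMap_eq, MvPolynomial.eval₂Hom_C, MvPolynomial.eval₂_C,
      IsScalarTower.algebraMap_apply k (Polynomial k) (Localization.Away (Polynomial.X : Polynomial k)) c,
      Polynomial.algebraMap_eq]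
  · fin_cases i
    · simp [psiN₀_X_zero]
    · simp [psiN₀_X_one, ev_algebraMap_X_one]

/-- **Key computation (general exponent).**  In `k[x]_x` with `u·x = 1` and `m ≥ 1`, the identity
`x^m − (H(u) − x^{m+1}·G(x)) = 0` is impossible over a non-trivial `k`: multiply by `x^N` (`N = deg H`,
`Polynomial.reflect`) and read off the coefficient of `x^{m+N}`: `1 = 0`. [folklore] -/
theorem key_contradiction_pow [Nontrivial k] (hm : 1 ≤ m) (G H : Polynomial k)
    {u : Localization.Away (Polynomial.X : Polynomial k)}
    (hu : u * algebraMap (Polynomial k) (Localization.Away (Polynomial.X : Polynomial k)) Polynomial.X = 1)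
    (h : algebraMap (Polynomial k) (Localization.Away (Polynomial.X : Polynomial k)) Polynomial.X ^ m -
        (Polynomial.eval₂ (algebraMap k _) u H -
          algebraMap (Polynomial k) _ Polynomial.X ^ (m + 1) * algebraMap (Polynomial k) _ G) = 0) : False := by
  set x : Localization.Away (Polynomial.X : Polynomial k) :=
    algebraMap (Polynomial k) (Localization.Away (Polynomial.X : Polynomial k)) Polynomial.X with hx
  haveI : Invertible x := ⟨u, hu, by rw [mul_comm]; exact hu⟩
  have hux : ⅟x = u := invOf_eq_left_inv hu
  have hrr : Polynomial.reflect H.natDegree (Polynomial.reflect H.natDegree H) = H :=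
    Polynomial.ext fun i ↦ by rw [Polynomial.coeff_reflect, Polynomial.coeff_reflect, Polynomial.revAt_invol]
  have hdeg : (Polynomial.reflect H.natDegree H).natDegree ≤ H.natDegree :=
    Polynomial.natDegree_le_iff_coeff_eq_zero.2 fun i hi ↦ by
      rw [Polynomial.coeff_reflect, Polynomial.revAt_eq_self_of_lt hi]
      exact Polynomial.coeff_eq_zero_of_natDegree_lt hi
  have hev : ∀ q : Polynomial k,
      Polynomial.eval₂ (algebraMap k (Localization.Away (Polynomial.X : Polynomial k))) x q =
        algebraMap (Polynomial k) (Localization.Away (Polynomial.X : Polynomial k)) q := by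
    intro q
    have e : Polynomial.eval₂RingHom (algebraMap k (Localization.Away (Polynomial.X : Polynomial k))) x =
        algebraMap (Polynomial k) (Localization.Away (Polynomial.X : Polynomial k)) :=
      Polynomial.ringHom_ext (fun a ↦ by
          rw [Polynomial.coe_eval₂RingHom, Polynomial.eval₂_C, IsScalarTower.algebraMap_apply k (Polynomial k)
            (Localization.Away (Polynomial.X : Polynomial k)) a, Polynomial.algebraMap_eq])
        (by rw [Polynomial.coe_eval₂RingHom, Polynomial.eval₂_X])
    exact DFunLike.congr_fun e q
  have h1 : Polynomial.eval₂ (algebraMap k _) u H * x ^ H.natDegree =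
      algebraMap (Polynomial k) _ (Polynomial.reflect H.natDegree H) := by
    have := Polynomial.eval₂_reflect_mul_pow (algebraMap k (Localization.Away (Polynomial.X : Polynomial k))) x
      H.natDegree (Polynomial.reflect H.natDegree H) hdeg
    rw [hrr, hux, hev] at this
    exact this
  have h2 : Polynomial.eval₂ (algebraMap k _) u H =
      x ^ m + x ^ (m + 1) * algebraMap (Polynomial k) (Localization.Away (Polynomial.X : Polynomial k)) G := by
    rw [sub_eq_zero] at h
    linear_combination -h
  have h3 : algebraMap (Polynomial k) (Localization.Away (Polynomial.X : Polynomial k))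
      ((1 + Polynomial.X * G) * Polynomial.X ^ (m + H.natDegree)) =
      algebraMap (Polynomial k) _ (Polynomial.reflect H.natDegree H) := by
    rw [← h1, h2]
    simp only [map_mul, map_add, map_pow, map_one, ← hx]
    ring
  have hinj : Function.Injective (algebraMap (Polynomial k) (Localization.Away (Polynomial.X : Polynomial k))) :=
    IsLocalization.injective _ (Submonoid.powers_le.2 (mem_nonZeroDivisors_iff_right.2 fun q hq ↦
      (Polynomial.isRegular_X (R := k)).right (show q * Polynomial.X = 0 * Polynomial.X by rw [hq, zero_mul])))
  have h4 := congrArg (fun q : Polynomial k ↦ q.coeff (0 + (m + H.natDegree))) (hinj h3)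
  rw [Polynomial.coeff_mul_X_pow, Polynomial.coeff_add, Polynomial.coeff_one_zero, Polynomial.mul_coeff_zero,
    Polynomial.coeff_X_zero, zero_mul, add_zero, zero_add, Polynomial.coeff_reflect,
    Polynomial.revAt_eq_self_of_lt (by omega), Polynomial.coeff_eq_zero_of_natDegree_lt (by omega)] at h4
  exact one_ne_zero h4

/-- **THE (−m−1)-CURVE DOES NOT LIFT (`m ≥ 1`).**  In the thickened atlas of `𝒪_{ℙ¹}(−m−1)` with the deformation
(`q = s^{m+1}p + εs^m`, `m ≥ 1`), the zero section `Z` has NO lift: the (0,1) coboundary equation of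
`exists_isAtlasLift_twisted_iff`, evaluated at `s^{m+1}p` and divided through, says
`s^m ≡ H(s⁻¹, s^{m+1}p) − s^{m+1}G (mod p)`; under `s ↦ x, p ↦ 0` this is `key_contradiction_pow`.  The obstruction
is the class of `s⁻¹ ≠ 0` in `H¹(ℙ¹, 𝒪(−m−1))`. [cite: Hartshorne2010, §6 Thm. 6.2 (b)] -/
theorem not_exists_isAtlasLift_minusN [Nontrivial k] (hm : 1 ≤ m) :
    ¬ ∃ K : Fin 2 → Ideal (A k)[ε],
      IsAtlasLift (fun _ : Fin 2 ↦ fstRingHom (A k)) (fun _ ↦ (ε : (A k)[ε])) (fun α _ ↦ mapRingHom (resMN k m α))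
        (fun α β ↦ (twist (thetaFamily k α β) : (L k)[ε] →+* (L k)[ε]).comp (mapRingHom (resMN k m β)))
        (idealZ k) K := by
  rintro hK
  have 𝔄 := thickenedAtlas_twisted (fun α _ ↦ resMN k m α) (fun _ β ↦ resMN k m β) (idealZ k) (idealZ₂ k)
    (thetaFamily k) (preservesLifts_resMN k m) (fun α β ↦ preservesLifts_resMN k m β α)
  have hsec := isLift_map_chartSection 𝔄 (fun _ ↦ algebraMap (A k) (A k)[ε]) fun _ ↦ fstRingHom_algebraMap
  obtain ⟨φ, hφ⟩ := (exists_isAtlasLift_twisted_iff (fun α _ ↦ resMN k m α) (fun _ β ↦ resMN k m β) (idealZ k)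
    (idealZ₂ k) (thetaFamily k) (preservesLifts_resMN k m) (fun α β ↦ preservesLifts_resMN k m β α)).1 hK
  -- the generator `p/1` of `I_L`, its multiple `s^{m+1}p = resMN 1 p`, representatives of `φ_α(p)`
  have hX1 : (X 1 : A k) ∈ idealZ k 0 := Ideal.subset_span rfl
  have hX1' : (X 1 : A k) ∈ idealZ k 1 := Ideal.subset_span rfl
  have hmem : algebraMap (A k) (L k) (X 1) ∈ idealZ₂ k 0 1 := Ideal.mem_map_of_mem _ (Ideal.subset_span rfl)
  have hmem₁ : resMN k m 1 (X 1) ∈ idealZ₂ k 0 1 := by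
    rw [resMN_one_X_one]
    exact Ideal.mul_mem_left _ _ hmem
  obtain ⟨y₀, hy₀⟩ := Ideal.Quotient.mk_surjective (φ 0 ⟨X 1, hX1⟩)
  obtain ⟨y₁, hy₁⟩ := Ideal.Quotient.mk_surjective (φ 1 ⟨X 1, hX1'⟩)
  have e0 : resL 𝔄 hsec 0 1 (φ 0) ⟨algebraMap (A k) (L k) (X 1), hmem⟩ =
      Ideal.Quotient.mk (idealZ₂ k 0 1) (algebraMap (A k) (L k) y₀) :=
    resNormal_apply (𝔄.homl 0 1) (𝔄.liftsl 0 1) (hsec 0) (φ 0) ⟨X 1, hX1⟩ y₀ hy₀ hmem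
  have e1 : resR 𝔄 hsec 0 1 (φ 1) ⟨resMN k m 1 (X 1), hmem₁⟩ =
      Ideal.Quotient.mk (idealZ₂ k 0 1) (resMN k m 1 y₁) :=
    resNormal_apply (𝔄.homr 0 1) (𝔄.liftsr 0 1) (hsec 1) (φ 1) ⟨X 1, hX1'⟩ y₁ hy₁ hmem₁
  have hx1 : (⟨resMN k m 1 (X 1), hmem₁⟩ : idealZ₂ k 0 1) =
      (algebraMap (A k) (L k) (X 0) ^ (m + 1)) • (⟨algebraMap (A k) (L k) (X 1), hmem⟩ : idealZ₂ k 0 1) :=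
    Subtype.ext (by
      show resMN k m 1 (X 1) = algebraMap (A k) (L k) (X 0) ^ (m + 1) • algebraMap (A k) (L k) (X 1)
      rw [resMN_one_X_one, smul_eq_mul])
  have e1' : resR 𝔄 hsec 0 1 (φ 1)
      ((algebraMap (A k) (L k) (X 0) ^ (m + 1)) • (⟨algebraMap (A k) (L k) (X 1), hmem⟩ : idealZ₂ k 0 1)) =
        Ideal.Quotient.mk (idealZ₂ k 0 1) (resMN k m 1 y₁) := by
    rw [← hx1]
    exact e1
  -- the (0,1) coboundary equation at `s^{m+1}·(p/1)`
  have key : algebraMap (A k) (L k) (X 0) ^ (m + 1) •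
      Ideal.Quotient.mk (idealZ₂ k 0 1)
        (theta k (IsLocalization.Away.invSelf (X 0 : A k)) (algebraMap (A k) (L k) (X 1))) =
      Ideal.Quotient.mk (idealZ₂ k 0 1) (resMN k m 1 y₁) -
        algebraMap (A k) (L k) (X 0) ^ (m + 1) • Ideal.Quotient.mk (idealZ₂ k 0 1) (algebraMap (A k) (L k) y₀) := by
    have h01 := LinearMap.congr_fun (hφ 0 1)
      ((algebraMap (A k) (L k) (X 0) ^ (m + 1)) • (⟨algebraMap (A k) (L k) (X 1), hmem⟩ : idealZ₂ k 0 1))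
    rw [LinearMap.sub_apply, map_smul (derivToNormal (idealZ₂ k 0 1) (thetaFamily k 0 1)),
      map_smul (resL 𝔄 hsec 0 1 (φ 0)), e1', e0, derivToNormal_apply, thetaFamily_zero_one] at h01
    exact h01
  rw [theta_algebraMap_X_one] at key
  have hsm : ∀ c a : L k, c • Ideal.Quotient.mk (idealZ₂ k 0 1) a = Ideal.Quotient.mk (idealZ₂ k 0 1) (c * a) :=
    fun _ _ ↦ rfl
  rw [hsm, hsm] at key
  have hc : algebraMap (A k) (L k) (X 0) ^ (m + 1) * IsLocalization.Away.invSelf (X 0 : A k) =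
      algebraMap (A k) (L k) (X 0) ^ m := by
    rw [pow_succ, mul_assoc, IsLocalization.Away.mul_invSelf, mul_one]
  rw [hc, ← map_sub, Ideal.Quotient.eq] at key
  -- `s^m − (psiN y₁ − s^{m+1} y₀) ∈ (p)·L`; map to `k[x]_x`
  have hev := ev_eq_zero_of_mem k key
  rw [map_sub, map_sub, map_mul, map_pow, map_pow, ev_algebraMap_X_zero, ev_algebraMap_eq k y₀, resMN_one,
    RingHom.comp_apply] at hev
  change _ - (ev k (psiNHom k m (algebraMap (A k) (L k) y₁)) - _) = 0 at hev
  rw [psiNHom_algebraMap, ← RingHom.comp_apply (ev k) (psiN₀ k m), ev_comp_psiN₀, eval₂Hom_pair_zero] at hev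
  -- `ev s⁻¹ · x = 1`
  have hinv : ev k (IsLocalization.Away.invSelf (X 0 : A k)) *
      algebraMap (Polynomial k) (Localization.Away (Polynomial.X : Polynomial k)) Polynomial.X = 1 := by
    rw [← ev_algebraMap_X_zero, ← map_mul, mul_comm, IsLocalization.Away.mul_invSelf, map_one]
  exact key_contradiction_pow k m hm _ _ hinv hev

/-- **THE ČECH CLASS OF THE (−m−1)-CURVE IS NON-ZERO (`m ≥ 1`)**: the cochain of the trivial local lifts `(p)·k[s,p][ε]`
(the same ideals on every rung of the ladder: `isLift_trivialLift_doubledLine` of `…CechNonzeroClass`) is not a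
coboundary (`exists_isAtlasLift_iff` contraposed). [cite: Hartshorne2010, §6 Thm. 6.2 (b)] -/
theorem cechCochain_minusN_not_coboundary [Nontrivial k] (hm : 1 ≤ m) :
    ¬ ∃ φ : ∀ α : Fin 2, idealZ k α →ₗ[A k] A k ⧸ idealZ k α, ∀ α β,
      cechCochain (thickenedAtlas_minusN k m) (isLift_trivialLift_doubledLine k) α β =
        resR (thickenedAtlas_minusN k m) (isLift_trivialLift_doubledLine k) α β (φ β) -
          resL (thickenedAtlas_minusN k m) (isLift_trivialLift_doubledLine k) α β (φ α) :=
  fun h ↦ not_exists_isAtlasLift_minusN k m hm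
    ((exists_isAtlasLift_iff (thickenedAtlas_minusN k m) (isLift_trivialLift_doubledLine k)).2 h)

end DoubledLine

end EmbeddedDeformation

end Summit.Ventures.HSemireg
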